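import Literature.Barriers.SmoothPoincare4.OneStabilisationContractible
import Literature.Barriers.SmoothPoincare4.ExoticContractibleProofs
import HarnessLib

/-!
# Proof architecture of `OneStabilisationBarrier`: Kang's Cor. 1.2 from his exotic pair and Freedman

Sibling proof file of `Literature/Barriers/SmoothPoincare4/OneStabilisationContractible.lean`
(D-0021 barrier `Literature.Barriers.OneStabilisationBarrier := ¬ OneStabilisationSufficesContractible`,
proved there from the named fact `kang2022_corollary12`). Two things are done here.

1. **The barrier is exactly Kang's corollary.** `oneStabilisationBarrier_iff_kang2022_corollary12`:
   pushing the negation through the binders of the master statement gives back the `∃`-statement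
   `kang2022_corollary12` (classical logic only). So the discharge `OneStabilisationBarrier_holds`
   is neither more nor less than a formal proof of Kang's Cor. 1.2 as rendered: exhibit two
   compact contractible smooth 4-manifolds, prove them homeomorphic with diffeomorphic
   boundaries, exhibit connected sums with `S² × S²`, prove those non-diffeomorphic.
2. **The printed proof of Cor. 1.2, one level down.** Kang's proof (§5, last paragraph) builds,
   from the cork `(Y, W, f)` of his Thm. 1.1 and Akbulut–Ruberman's invertible homology
   cobordism `X : Y → N`, the manifolds `V = W ∪ X`, `V′ = W ∪_f X` (same boundary `N`), "which
   are simply-connected homology balls by [AR16, Proposition 2.6], so that they are contractible,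
   hence homeomorphic. Then one can simply follow the remaining part of the proof of [AR16,
   Theorem A] to conclude that there exists no diffeomorphism between `V ♯ (S² × S²)` and
   `V′ ♯ (S² × S²)`." The step "contractible [with the same boundary], hence homeomorphic" is
   Freedman's theorem, which the tree carries as the named fact
   `freedmanQuinn1990_homeomorph_extends_contractible` (`ExoticContractibleProofs.lean`, the
   same step of Akbulut–Ruberman's proof of their Thm. B). The rest — the pair `(V, V′)` with
   diffeomorphic boundaries and non-diffeomorphic one-fold stabilisations — is the SMOOTH content
   of the paper (Thm. 1.1: involutive bordered Heegaard Floer homology, §§3–5; the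
   Akbulut–Ruberman mechanism, §2 of loc. cit.; existence of the connected sums, Kervaire–Milnor)
   and is vendored as the named fact `kang2022_oneStabilisationExoticPair`. Cor. 1.2, hence the
   barrier, is PROVED from the two (`kang2022_corollary12_of_exoticPair`,
   `oneStabilisationBarrier_of_exoticPair`); conversely the new fact is a formal weakening of
   Cor. 1.2 (`kang2022_oneStabilisationExoticPair_of_corollary12`).

Resulting dependency graph (all arrows proved in the tree):
`OneStabilisationBarrier ⇔ kang2022_corollary12 ⇐ kang2022_oneStabilisationExoticPair ∧
freedmanQuinn1990_homeomorph_extends_contractible`. The two leaves are named facts (D-0014):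
Floer theory plus 4-dimensional handle constructions, and the disc embedding theorem. Kang's
Thm. 1.1 itself (the cork-level statement "`f` does not extend to a self-diffeomorphism of
`W ♯ (S² × S²)`") is not rendered: it needs the boundary of the connected sum as a datum, i.e.
the gluing embedding `W ∖ {pt} → W ♯ (S² × S²)`, which the tree's relational
`Literature.Topology.FourManifolds.IsConnectedSum` keeps inside an existential (scope caveat (c) of the barrier docstring).

## What is printed

* Kang (arXiv:2210.07510v3), Cor. 1.2: "There exist homeomorphic smooth contractible
  4-manifolds `W₁`, `W₂`, with diffeomorphic boundaries, such that `W₁ ♯ (S² × S²)` and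
  `W₂ ♯ (S² × S²)` are not diffeomorphic."; its proof (§5, pp. 20–21): "By Theorem 1.1, we know
  that there exists a cork `(W, Y, f)` such that `f` does not extend smoothly to
  `W ♯ (S² × S²)`. By following the arguments used in the proof of [AR16, Theorem A], one can
  construct a homology cobordism `X` from `Y` to another homology sphere `N`, admitting a left
  inverse `X̄`, i.e. `X̄ ∪_N X ≃ Y × I`, such that any self-diffeomorphism of `N` extends to a
  self-diffeomorphism of `X` which acts by identity on `Y`. Then we consider the 4-manifolds
  `V = W ∪ X`, `V′ = W ∪_f X`, which are simply-connected homology balls by [AR16,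
  Proposition 2.6], so that they are contractible, hence homeomorphic. Then one can simply follow
  the remaining part of the proof of [AR16, Theorem A] to conclude that there exists no
  diffeomorphism between `V ♯ (S² × S²)` and `V′ ♯ (S² × S²)`."
* Akbulut–Ruberman 2016 (arXiv:1410.1461 = Comment. Math. Helv. 91), Thm. A (§1) and its proof
  (§2): "Form the union `V = W ∪_M X`, where `X` is an invertible homology cobordism from
  `M = ∂W` to some other 3-manifold `N` ... Cutting out the embedded copy of `W` in `V` and
  regluing via `f` results in a manifold `V′`"; "Since `V` and `V′` are simply connected homology
  balls, they are contractible, hence homeomorphic."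
* Freedman–Quinn 1990, Prop. 11.1C / Cor. 9.3C, as quoted in `ExoticContractibleProofs.lean`.

## Rendering choices (wording risks for the reviewer)

* `kang2022_oneStabilisationExoticPair` has exactly the shape of `kang2022_corollary12` with the
  conjunct `Nonempty (W₁ ≃ₜ W₂)` removed: compact (Hausdorff, second countable) contractible
  smooth `V`, `V′` (`V = W ∪ X` with `W`, `X` compact; "contractible" is printed), boundary data
  with `∂V ≅ ∂V′` (in print both boundaries ARE `N`), and — in `∃`-form over the tree's
  relational, orientation-free `Literature.Topology.FourManifolds.IsConnectedSum`, the weakest reading, as in the barrier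
  file — some connected sums `P` of `V` and `P′` of `V′` with `S² × S²` that are not
  diffeomorphic (`IsEmpty (P ≃ₘ P′)`); the printed "there exists no diffeomorphism between
  `V ♯ (S² × S²)` and `V′ ♯ (S² × S²)`" for the well-defined `♯` implies it. The existence of the
  sums (Kervaire–Milnor) is thereby folded into the fact, as it is in `kang2022_corollary12`.
* Universe: the barrier file quantifies over `Type`; the Freedman–Quinn fact is instantiated at
  universe `0`.

## Reach over involutive corks (barrier audit 2026-08-16)

The barrier's `blocks:` line (`OneStabilisationContractible.lean`) names "any proof of S1 through a
cork-level lemma 'every cork is undone by one stabilisation'". Two readings of "cork" are in play,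
and the audit records how far the PRINTED material reaches under each (no statement of this file or
of the barrier changes; this section is prose).

* **Kang's reading (arbitrary boundary diffeomorphism).** Kang's definition (§1, p. 1 and §3,
  p. 11): "`f : Y → Y` is a diffeomorphism which does not extend smoothly to `W`" — no order
  condition. The cork of Thm. 1.1 is `(S³₊₁(K ♯ −K), B⁴₊₁(D_{K,id}), F)` with `F` induced by
  `f = f₂ ∘ f₁`, `f₁` the swap of the two `K₀`-summands of `K = K₀ ♯ K₀` and `f₂` "the 'half Dehn
  twist' diffeomorphism ... which acts as identity outside a tubular neighborhood `ν(K)` of `K`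
  and acts on `K` as a half rotation" (§3, p. 12); `F` is nowhere claimed to be an involution, and
  the infinitely many further pairs of Guth–Kang (Thm. 1.8; §8: "a diffeomorphism considered in
  [JZ21] related to swapping the summands of the knot `K ♯ K`") are built the same way. Under
  this reading the lemma is refuted verbatim by Thm. 1.1 (`kang2022_theorem11`,
  `OneStabilisationContractibleCorkProofs.lean`). No ORDER-TWO cork surviving one stabilisation
  is exhibited in print (search of the 17 works citing Kang, 2022–2026, audit date).
* **The cork theorem's reading (tree `Literature.Topology.FourManifolds.IsCork`: an INVOLUTION of
  `∂C` extending to a homeomorphism but to no diffeomorphism of `C`).** This is the reading a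
  route to S1 through the cork theorem uses: "Corollary: Any homotopy 4-sphere, `Σ⁴`, can be
  constructed by cutting out a contractible 4-manifold, `A₀` from `S⁴` and gluing it back in by
  an involution of `∂A₀`" (Kirby 1996, p. 1, from the decomposition theorem of
  Curtis–Freedman–Hsiang–Stong and Matveyev with Matveyev's Addendum (D): "`A₀` is diffeomorphic
  to `A₁` by a diffeomorphism which, restricted to `∂A₀ = ∂A₁`, is an involution"). The printed
  theorems still refute "every involutive cork is undone by one stabilisation", but only
  NON-CONSTRUCTIVELY, by the following assembly (recorded here because no source prints it):
  (1) Kang, §3 p. 12: surviving a stabilisation "is equivalent to showing that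
  `B⁴₊₁(D_{K,id}) ♯ (S² × S²)` and `B⁴₊₁(D_{K,f}) ♯ (S² × S²)` are not diffeomorphic rel
  boundary" — two compact contractible fillings `W₁`, `W₂` of ONE homology sphere `Y`;
  (2) `Σ = W₁ ∪_Y −W₂` is a smooth simply connected homology 4-sphere, hence a homotopy 4-sphere,
  hence (`Θ₄ = 0`, Kervaire–Milnor; the same input as in Kirby's Corollary) h-cobordant to `S⁴`,
  so `Σ` bounds a contractible smooth `Z⁵`, which — inserting a collar `Y × I` — is an
  h-cobordism from `W₁` to `W₂` that is the product `Y × I` on the side;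
  (3) the decomposition theorem for this relative h-cobordism (Curtis–Freedman–Hsiang–Stong's
  title says "compact 4-manifolds"; Kirby's exposition states the closed case; Akbulut–Ruberman,
  §1, invoke it in exactly this bounded situation: "The cork theorem [CFHS, Matveyev] implies that
  `V′` is obtained from `V` by a cork-twisting operation in the interior"; the involution is
  Matveyev's Addendum (D), whose proof is internal to the sub-h-cobordism) gives a compact
  contractible `C ⊂ W₁ ∖ Y` and an involution `τ` of `∂C` with
  `W₂ ≅ (W₁ ∖ C̊) ∪_τ C` rel `Y`;
  (4) if `τ` were the restriction of a self-diffeomorphism `Φ` of `C ♯ (S² × S²)` (sum inside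
  `C`), then `id ∪ Φ : (W₁ ∖ C̊) ∪_{id} (C ♯ (S² × S²)) → (W₁ ∖ C̊) ∪_τ (C ♯ (S² × S²))` is well
  defined on the seam (a seam point `x ∼ x` goes to `τ x ∼ x`, an identified pair of the target)
  and, after straightening collars, a diffeomorphism `W₁ ♯ (S² × S²) ≅ W₂ ♯ (S² × S²)` rel `Y`
  (the sum may be taken inside `C` since `W₂` is connected) — contradicting (1); this is the
  stabilised form of the tree's `nonempty_diffeomorph_of_extendsToDiffeomorph`
  (`ExoticContractibleCorkTheoremProofs.lean`). By Freedman `τ` extends to a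
  homeomorphism of `C` (compact contractible; the tree's
  `freedmanQuinn1990_homeomorph_extends_contractible`), and it extends to no diffeomorphism of
  `C` — such an extension would give `W₁ ≅ W₂` rel `Y` by the same gluing, whereas `(Y, W₁, F)`
  is a cork (equivalently: an extension over `C` yields one over `C ♯ (S² × S²)` by the disc
  theorem, excluded by (4)). So `(C, τ)` satisfies the tree's `IsCork` (compact, contractible,
  `τ` involutive, extends topologically, not smoothly), lies inside `B⁴₊₁(D_{K,id})`, and is
  undone by no single stabilisation. Step (3) in the bounded, rel-boundary form is
  folklore-level (printed for closed manifolds; asserted for the bounded case by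
  Akbulut–Ruberman); the tree's own `Literature.Topology.FourManifolds.corkDecomposition` /
  `Matveyev1996_decomposition` carry neither the boundary nor the involution refinement, so the
  assembly is not formalised here.
* **What is left for S1.** The sub-class the cork-theorem route to S1 actually needs is "every
  involutive cork EMBEDDED IN `S⁴` as the cork of an h-cobordism `S⁴ ∼ Σ` is undone by one
  stabilisation"; by Kirby's Corollary that statement already yields S1 (`Σ ♯ (S² × S²) ≅
  S⁴ ♯ (S² × S²)` for every homotopy 4-sphere) and is at least as strong, and no printed result
  bears on it: the barrier leaves no cork-level gap short of the problem. Kang's `W₁ =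
  B⁴₊₁(D_{K,id})` (slice-disc exterior plus a `(−1)`-framed meridional 2-handle,
  Hayden–Kang–Mukherjee §2.1) is not claimed to embed in `S⁴`. Complementary positive results at
  cork level — one TWISTED stabilisation dissolves every slice-disc-surgery pair
  `B⁴_{1/k}(D), B⁴_{1/k}(D′)` with `k` odd, one `S² × S²` those with `k` even
  (Hayden–Kang–Mukherjee, Lemma 3.1, Prop. 3.3), and corks with a single algebraically dual
  pair of a 1-handle and a 2-handle, such as the positron cork, dissolve after one `S² × S²`
  (Hayden 2023, Example 2.1) — are recorded in the barrier's `evasions_known:` (2)–(4).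

## References

[Kang2022OneStabilization] [AkbulutRuberman2016] [FreedmanQuinn1990] [WallJLMS1964]
[GuthKang2024] [KirbyCorks1996] [CurtisFreedmanHsiangStong1996] [Matveyev1996]
[KervaireMilnorAnnals1963] [HaydenKangMukherjee2023] [Hayden2023]
-/

noncomputable section

open scoped Manifold ContDiff

namespace Literature.Barriers.SmoothPoincare4

/-! ### The barrier is exactly Kang's corollary (classical logic) -/

/-- **Kang's Cor. 1.2 (as rendered) follows from the barrier**: if one stabilisation does not
suffice for compact contractible 4-manifolds, then there are homeomorphic compact contractible
smooth 4-manifolds with diffeomorphic boundaries and non-diffeomorphic connected sums with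
`S² × S²` — the contrapositive unpacking of `¬ ∀` into `∃ ¬` (classical logic only, no topology).
[cite: Kang2022OneStabilization, Cor. 1.2] -/
theorem kang2022_corollary12_of_oneStabilisationBarrier (h : OneStabilisationBarrier) :
    kang2022_corollary12 := by
  by_contra hK
  apply h
  intro W₁ W₂ _ _ _ _ _ _ _ _ _ _ _ _ _ _ b₁ b₂ hB hW P₁ P₂ _ _ _ _ _ _ _ _ _ _ hP₁ hP₂
  by_contra hE
  exact hK ⟨W₁, W₂, ‹_›, ‹_›, ‹_›, ‹_›, ‹_›, ‹_›, ‹_›, ‹_›, ‹_›, ‹_›, ‹_›, ‹_›, ‹_›, ‹_›, b₁, b₂,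
    P₁, P₂, ‹_›, ‹_›, ‹_›, ‹_›, ‹_›, ‹_›, ‹_›, ‹_›, ‹_›, ‹_›, hB, hW, hP₁, hP₂,
    not_nonempty_iff.mp hE⟩

/-- **The barrier is equivalent to Kang's Cor. 1.2 (as rendered)**:
`OneStabilisationBarrier ↔ kang2022_corollary12` (`oneStabilisationBarrier_of_kang` and
`kang2022_corollary12_of_oneStabilisationBarrier`). Discharging the barrier unconditionally is
therefore exactly formalising Kang's corollary. [cite: Kang2022OneStabilization, Cor. 1.2] -/
theorem oneStabilisationBarrier_iff_kang2022_corollary12 :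
    OneStabilisationBarrier ↔ kang2022_corollary12 :=
  ⟨kang2022_corollary12_of_oneStabilisationBarrier, oneStabilisationBarrier_of_kang⟩

/-! ### Named fact: the pair `(V, V′)` of Kang's proof of Cor. 1.2 -/

/-- **Kang 2022, the exotic pair of the proof of Cor. 1.2 (named fact).** There are compact
(Hausdorff, second countable) contractible smooth 4-manifolds `V`, `V′` with diffeomorphic
boundaries, and connected sums `P` of `V` with `S² × S²` and `P′` of `V′` with `S² × S²`, such
that `P` and `P′` are not diffeomorphic. In print: from the cork `(Y, W, f)` of Thm. 1.1 (`f` does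
not extend to a self-diffeomorphism of `W ♯ (S² × S²)`, by involutive bordered Heegaard Floer
homology) and an invertible homology cobordism `X` from `Y` to a homology sphere `N` all of whose
self-diffeomorphisms extend over `X` as the identity on `Y` (Akbulut–Ruberman), "we consider the
4-manifolds `V = W ∪ X`, `V′ = W ∪_f X`, which are simply-connected homology balls by [AR16,
Proposition 2.6], so that they are contractible ... one can simply follow the remaining part of
the proof of [AR16, Theorem A] to conclude that there exists no diffeomorphism between
`V ♯ (S² × S²)` and `V′ ♯ (S² × S²)`" (both have boundary `N`). This is Cor. 1.2 WITHOUT its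
clause "homeomorphic" (which the print obtains from Freedman's theorem,
`kang2022_corollary12_of_exoticPair`); same shape as `kang2022_corollary12`: boundary data with
`∂V ≅ ∂V′`, the sums in `∃`-form over the tree's relational `Literature.Topology.FourManifolds.IsConnectedSum` (for SOME
connected sums, the weakest reading, implied by the printed statement about the well-defined
`♯`; the existence of the sums is thereby part of the fact). Users take
`(h : kang2022_oneStabilisationExoticPair)`.
[cite: Kang2022OneStabilization, proof of Cor. 1.2 (§5) and Thm. 1.1] [cite: AkbulutRuberman2016, Thm. A and its proof (§2)] -/
def kang2022_oneStabilisationExoticPair : Prop :=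
  ∃ (V V' : Type) (_ : TopologicalSpace V) (_ : T2Space V) (_ : SecondCountableTopology V)
    (_ : ChartedSpace (EuclideanHalfSpace 4) V) (_ : IsManifold (𝓡∂ 4) ∞ V) (_ : CompactSpace V)
    (_ : ContractibleSpace V)
    (_ : TopologicalSpace V') (_ : T2Space V') (_ : SecondCountableTopology V')
    (_ : ChartedSpace (EuclideanHalfSpace 4) V') (_ : IsManifold (𝓡∂ 4) ∞ V') (_ : CompactSpace V')
    (_ : ContractibleSpace V')
    (b : Literature.Topology.FourManifolds.BoundaryData (𝓡∂ 4) V (𝓡 3)) (b' : Literature.Topology.FourManifolds.BoundaryData (𝓡∂ 4) V' (𝓡 3))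
    (P P' : Type) (_ : TopologicalSpace P) (_ : T2Space P) (_ : SecondCountableTopology P)
    (_ : ChartedSpace (EuclideanHalfSpace 4) P) (_ : IsManifold (𝓡∂ 4) ∞ P)
    (_ : TopologicalSpace P') (_ : T2Space P') (_ : SecondCountableTopology P')
    (_ : ChartedSpace (EuclideanHalfSpace 4) P') (_ : IsManifold (𝓡∂ 4) ∞ P'),
    Nonempty (b.carrier ≃ₘ⟮𝓡 3, 𝓡 3⟯ b'.carrier) ∧
      Literature.Topology.FourManifolds.IsConnectedSum (𝓡∂ 4) (𝓡∂ 4) ((𝓡 2).prod (𝓡 2)) V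
        (Metric.sphere (0 : EuclideanSpace ℝ (Fin 3)) 1 × Metric.sphere (0 : EuclideanSpace ℝ (Fin 3)) 1)
        P ∧
      Literature.Topology.FourManifolds.IsConnectedSum (𝓡∂ 4) (𝓡∂ 4) ((𝓡 2).prod (𝓡 2)) V'
        (Metric.sphere (0 : EuclideanSpace ℝ (Fin 3)) 1 × Metric.sphere (0 : EuclideanSpace ℝ (Fin 3)) 1)
        P' ∧
      IsEmpty (P ≃ₘ⟮𝓡∂ 4, 𝓡∂ 4⟯ P')

/-- The new fact is formally WEAKER than Cor. 1.2 as rendered: drop the homeomorphism clause.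
[cite: Kang2022OneStabilization, Cor. 1.2] -/
theorem kang2022_oneStabilisationExoticPair_of_corollary12 (hK : kang2022_corollary12) :
    kang2022_oneStabilisationExoticPair := by
  obtain ⟨W₁, W₂, _, _, _, _, _, _, _, _, _, _, _, _, _, _, b₁, b₂, P₁, P₂, _, _, _, _, _, _, _, _,
    _, _, hB, -, hP₁, hP₂, hE⟩ := hK
  exact ⟨W₁, W₂, ‹_›, ‹_›, ‹_›, ‹_›, ‹_›, ‹_›, ‹_›, ‹_›, ‹_›, ‹_›, ‹_›, ‹_›, ‹_›, ‹_›, b₁, b₂,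
    P₁, P₂, ‹_›, ‹_›, ‹_›, ‹_›, ‹_›, ‹_›, ‹_›, ‹_›, ‹_›, ‹_›, hB, hP₁, hP₂, hE⟩

/-! ### Cor. 1.2 and the barrier from the exotic pair and Freedman–Quinn -/

/-- **Kang's Cor. 1.2 from its printed proof**: the pair `(V, V′)` with diffeomorphic boundaries
and non-diffeomorphic one-fold stabilisations (hypothesis `hK`) is homeomorphic by Freedman's
theorem (hypothesis `hF`, Freedman–Quinn 11.1C for the trivial group, through
`nonempty_homeomorph_of_freedmanQuinn`) — "so that they are contractible, hence homeomorphic".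
[cite: Kang2022OneStabilization, proof of Cor. 1.2 (§5)] [cite: FreedmanQuinn1990, Prop. 11.1C (trivial group) and Cor. 9.3C] -/
theorem kang2022_corollary12_of_exoticPair (hK : kang2022_oneStabilisationExoticPair)
    (hF : freedmanQuinn1990_homeomorph_extends_contractible.{0}) : kang2022_corollary12 := by
  obtain ⟨V, V', _, _, _, _, _, _, _, _, _, _, _, _, _, _, b, b', P, P', _, _, _, _, _, _, _, _,
    _, _, ⟨ψ⟩, hP, hP', hE⟩ := hK
  exact ⟨V, V', ‹_›, ‹_›, ‹_›, ‹_›, ‹_›, ‹_›, ‹_›, ‹_›, ‹_›, ‹_›, ‹_›, ‹_›, ‹_›, ‹_›, b, b',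
    P, P', ‹_›, ‹_›, ‹_›, ‹_›, ‹_›, ‹_›, ‹_›, ‹_›, ‹_›, ‹_›, ⟨ψ⟩,
    nonempty_homeomorph_of_freedmanQuinn hF b b' ⟨ψ.toHomeomorph⟩, hP, hP', hE⟩

/-- With Freedman–Quinn (hypothesis `hF`), Kang's Cor. 1.2 as rendered is EQUIVALENT to the
existence of the exotic pair of its proof. [cite: Kang2022OneStabilization, Cor. 1.2 and its proof (§5)] -/
theorem kang2022_corollary12_iff_exoticPair
    (hF : freedmanQuinn1990_homeomorph_extends_contractible.{0}) :
    kang2022_corollary12 ↔ kang2022_oneStabilisationExoticPair :=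
  ⟨kang2022_oneStabilisationExoticPair_of_corollary12, fun hK =>
    kang2022_corollary12_of_exoticPair hK hF⟩

/-- **`OneStabilisationBarrier` from the leaves of its printed proof**: Kang's exotic pair
(`hK`: Thm. 1.1 plus the Akbulut–Ruberman construction) and Freedman–Quinn 11.1C (`hF`); via
`kang2022_corollary12_of_exoticPair` and `oneStabilisationBarrier_of_kang`.
[cite: Kang2022OneStabilization, Cor. 1.2 and its proof (§5)] -/
theorem oneStabilisationBarrier_of_exoticPair (hK : kang2022_oneStabilisationExoticPair)
    (hF : freedmanQuinn1990_homeomorph_extends_contractible.{0}) : OneStabilisationBarrier :=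
  oneStabilisationBarrier_of_kang (kang2022_corollary12_of_exoticPair hK hF)

end Literature.Barriers.SmoothPoincare4

end
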